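import Literature.NumberTheory.EllipticCurves.SteinWuthrich2013.SplitMultCanonicalOfThetaRelationProofs
import Literature.NumberTheory.EllipticCurves.TateCurve.TateThetaRelation
import HarnessLib

/-!
# Stein–Wuthrich 2013 §4.2: the canonical `p`-adic height at a split multiplicative prime `p ≠ 2`
# EXISTS — discharge of the named fact `exists_isSplitMultCanonical` (proofs only)

Topic `Literature/NumberTheory/EllipticCurves` (cluster `SteinWuthrich2013`); proof file (one
theorem, nothing asserted, no definition). Cell `bsd-eis`, seat `bsd-eis-k5-c4` g3: this closes the
PUB fact `SteinWuthrich2013.exists_isSplitMultCanonical` (`MultiplicativeHeightExistence.lean`;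
conjunct `hHs` of `stub_publishedFacts` of crux 4 `BSDpOnCellC` of route `EisensteinPrimes`,
stmt-BirchSwinnertonDyer-19034).

`exists_isSplitMultCanonical_of_thetaRelation` (`SplitMultCanonicalOfThetaRelationProofs.lean`)
reduced the fact to Silverman's theta relation ATAEC Prop. V.3.2 (b)(i) on Tate curves over `ℚ_p`;
`TateCurve.tate_thetaRelation` (`TateCurve/TateThetaRelation.lean`) proves that relation in every
complete nontrivially normed field by `q`-expansion transfer from the complex `σ`-identity
`℘(z) − ℘(w) = −σ(z−w)σ(z+w)/σ(z)²σ(w)²`.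

* `exists_isSplitMultCanonical_holds : exists_isSplitMultCanonical`.

## Sources

* W. Stein, C. Wuthrich, *Algorithms for the arithmetic of elliptic curves using Iwasawa theory*,
  Math. Comp. 82 (2013), §4.2 (pp. 15–16). [SteinWuthrich2013]
* J. H. Silverman, *Advanced Topics in the Arithmetic of Elliptic Curves* (1994), Prop. V.3.2.
  [SilvermanATAEC1994]
-/

noncomputable section

namespace Literature.NumberTheory.EllipticCurves.SteinWuthrich2013

open Literature.NumberTheory.EllipticCurves.TateCurve

/-- **Stein–Wuthrich 2013 §4.2, existence of the canonical `p`-adic height at a split multiplicative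
prime `p ≠ 2`** (the named fact `exists_isSplitMultCanonical`): for `W/ℚ` globally minimal,
`p ≠ 2` and Tate data `Dq` at a split multiplicative `p`, there is a `PAdicHeightData W p` whose
pairing on `E₁(ℚ_p)`-admissible points is SW's formula (4.1) in the split normalisation. Proof:
`exists_isSplitMultCanonical_of_thetaRelation` + `TateCurve.tate_thetaRelation` at `K = ℚ_p`.
[Stein–Wuthrich 2013, §4.2 (pp. 15–16); Silverman ATAEC Prop. V.3.2 (b)(i)]
[cite: SteinWuthrich2013, §4.2 (pp. 15–16)] [cite: SilvermanATAEC1994, Prop. V.3.2 (b) (PDF p. 399)] -/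
theorem exists_isSplitMultCanonical_holds : exists_isSplitMultCanonical :=
  exists_isSplitMultCanonical_of_thetaRelation fun _p _ _hp2 _q hq0 hq _u₁ _u₂ hu₁ hu₂ h₁ h₂ =>
    tate_thetaRelation hq0 hq hu₁ hu₂ h₁ h₂

end Literature.NumberTheory.EllipticCurves.SteinWuthrich2013

end
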